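import Literature.Topology.FourManifolds.TubePacing
import Mathlib.Analysis.SpecialFunctions.Log.Deriv
import HarnessLib

/-!
# Log-slow pacing of the untwist zone

Topic `Literature/Topology/FourManifolds`; the pacing function of the black-box untwist zone of a tube
(downward sweep of the smoothing of PD homeomorphisms; Munkres, Ann. of Math. 72 (1960), §5;
Campbell–D'Onofrio–Vítek (2026), §4).  The radial family zone `radialFamilyMap ρ Ψ λ` exports a
target Euler defect `ρ t (t λ'(t)) ‖∂_s Ψ‖` (`radialFamilyMap_euler_defect`), and a face reading this
zone divides it by the (black-box) fibre constant of the family; so the SLOWNESS `t |λ'(t)|` must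
be made as small as required AFTER the family is known.  The log-slow pacing

  `logPacing t₀ t₁ t = 2 · rampCutoff (log t₀) (log t₁) (log t)`   (`0 < t₀ < t₁`)

rises from `0` (for `t ≤ t₀`) to `2` (for `t ≥ t₁`), is smooth on `(0, ∞)`, and satisfies
`t |λ'(t)| ≤ 2 C / log (t₁ / t₀)` for `t > 0` with the universal constant `C` of
`exists_deriv_smoothTransition_bound` — arbitrarily small as the core depth `t₀ → 0`.  These are
exactly the hypotheses `hlam`, `hlam2` (`t₁ = 3r/32`), `hlam0` of `contDiffAt_tubeStageMap` /
`exists_hasFDerivAt_equiv_tubeStageMap`.  The definition is an explicit function; no named facts.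

## References

* J. R. Munkres, *Obstructions to the smoothing of piecewise-differentiable homeomorphisms*, Ann.
  of Math. (2) 72 (1960), 521–554, §5. [Munkres1960]
* D. Campbell, L. D'Onofrio, T. Vítek, *Diffeomorphic approximation of piecewise affine
  homeomorphisms*, J. Geom. Anal. 36 (2026), §4. [CampbellDonofrioVitek2026]
-/

noncomputable section

open Set Function Metric Filter Real
open scoped Topology ContDiff

namespace Literature.Topology.FourManifolds

/-- **The log-slow pacing** `t ↦ 2 · rampCutoff (log t₀) (log t₁) (log (max t t₀))` (the `max`
guard makes it vanish for ALL `t ≤ t₀`, as the stage lemmas require; on `(0, ∞)` it agrees with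
the unguarded formula, see `logPacing_eq_of_pos`). [folklore] -/
def logPacing (t₀ t₁ t : ℝ) : ℝ := 2 * rampCutoff (Real.log t₀) (Real.log t₁) (Real.log (max t t₀))

variable {t₀ t₁ : ℝ}

/-- Below the core radius the pacing vanishes (for every `t ≤ t₀`). [folklore] -/
theorem logPacing_of_le (h₀ : 0 < t₀) (h₁ : t₀ < t₁) {t : ℝ} (ht : t ≤ t₀) : logPacing t₀ t₁ t = 0 := by
  rw [logPacing, max_eq_right ht, rampCutoff_of_le (Real.log_lt_log h₀ h₁) le_rfl, mul_zero]

/-- On `(0, ∞)` the pacing agrees with the unguarded formula. [folklore] -/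
theorem logPacing_eq_of_pos (h₀ : 0 < t₀) (h₁ : t₀ < t₁) {t : ℝ} (ht : 0 < t) :
    logPacing t₀ t₁ t = 2 * rampCutoff (Real.log t₀) (Real.log t₁) (Real.log t) := by
  rcases le_or_gt t t₀ with h | h
  · rw [logPacing_of_le h₀ h₁ h, rampCutoff_of_le (Real.log_lt_log h₀ h₁) (Real.log_le_log ht h), mul_zero]
  · rw [logPacing, max_eq_left h.le]

/-- Near a positive point the pacing is eventually the unguarded formula. [folklore] -/
theorem logPacing_eventuallyEq (h₀ : 0 < t₀) (h₁ : t₀ < t₁) {t : ℝ} (ht : 0 < t) :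
    logPacing t₀ t₁ =ᶠ[𝓝 t] fun s => 2 * rampCutoff (Real.log t₀) (Real.log t₁) (Real.log s) := by
  filter_upwards [Ioi_mem_nhds ht] with s hs
  exact logPacing_eq_of_pos h₀ h₁ hs

/-- Beyond `t₁` the pacing equals `2`. [folklore] -/
theorem logPacing_of_ge (h₀ : 0 < t₀) (h₁ : t₀ < t₁) {t : ℝ} (ht : t₁ ≤ t) : logPacing t₀ t₁ t = 2 := by
  have ht1 : 0 < t₁ := h₀.trans h₁
  rw [logPacing_eq_of_pos h₀ h₁ (ht1.trans_le ht), rampCutoff_of_ge (Real.log_lt_log h₀ h₁) (Real.log_le_log ht1 ht),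
    mul_one]

/-- The pacing takes values in `[0, 2]`. [folklore] -/
theorem logPacing_mem_Icc (t₀ t₁ t : ℝ) : logPacing t₀ t₁ t ∈ Icc (0 : ℝ) 2 := by
  have h := rampCutoff_mem_Icc (Real.log t₀) (Real.log t₁) (Real.log (max t t₀))
  rw [logPacing]; constructor <;> linarith [h.1, h.2]

/-- **Smoothness on `(0, ∞)`.** [folklore] -/
theorem contDiffAt_logPacing (h₀ : 0 < t₀) (h₁ : t₀ < t₁) {t : ℝ} (ht : 0 < t) :
    ContDiffAt ℝ ∞ (logPacing t₀ t₁) t := by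
  refine ContDiffAt.congr_of_eventuallyEq ?_ (logPacing_eventuallyEq h₀ h₁ ht)
  exact contDiffAt_const.mul
    ((contDiff_rampCutoff _ _).contDiffAt.comp t (Real.contDiffAt_log.2 ht.ne'))

/-- **Derivative.** `λ'(t) = 2 · rampCutoff'(log t) / t` for `t > 0`. [folklore] -/
theorem hasDerivAt_logPacing (h₀ : 0 < t₀) (h₁ : t₀ < t₁) {t : ℝ} (ht : 0 < t) :
    HasDerivAt (logPacing t₀ t₁)
      (2 * (deriv smoothTransition ((Real.log t - Real.log t₀) / (Real.log t₁ - Real.log t₀)) /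
        (Real.log t₁ - Real.log t₀) * t⁻¹)) t := by
  have h := (hasDerivAt_rampCutoff (a := Real.log t₀) (b := Real.log t₁) (Real.log t)).comp t
    (Real.hasDerivAt_log ht.ne')
  exact (h.const_mul 2).congr_of_eventuallyEq (logPacing_eventuallyEq h₀ h₁ ht)

/-- **Log-slowness**: `t |λ'(t)| ≤ 2 C / log (t₁/t₀)` for `t > 0`, with the universal derivative bound
`C` of the smooth transition. [folklore] -/
theorem abs_mul_deriv_logPacing_le (h₀ : 0 < t₀) (h₁ : t₀ < t₁) {C : ℝ}
    (hC : ∀ x : ℝ, 0 ≤ deriv smoothTransition x ∧ deriv smoothTransition x ≤ C) {t : ℝ} (ht : 0 < t) :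
    t * |deriv (logPacing t₀ t₁) t| ≤ 2 * C / Real.log (t₁ / t₀) := by
  have hlog : 0 < Real.log t₁ - Real.log t₀ := sub_pos.2 (Real.log_lt_log h₀ h₁)
  have hlog' : Real.log (t₁ / t₀) = Real.log t₁ - Real.log t₀ := Real.log_div (h₀.trans h₁).ne' h₀.ne'
  rw [(hasDerivAt_logPacing h₀ h₁ ht).deriv, hlog']
  set D := deriv smoothTransition ((Real.log t - Real.log t₀) / (Real.log t₁ - Real.log t₀)) with hD
  have hD0 : 0 ≤ D := (hC _).1
  have hDC : D ≤ C := (hC _).2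
  rw [abs_mul, abs_of_pos (by norm_num : (0:ℝ) < 2), abs_mul, abs_div, abs_of_nonneg hD0, abs_of_pos hlog,
    abs_inv, abs_of_pos ht]
  calc t * (2 * (D / (Real.log t₁ - Real.log t₀) * t⁻¹)) = 2 * (D / (Real.log t₁ - Real.log t₀)) := by
        field_simp
    _ ≤ 2 * (C / (Real.log t₁ - Real.log t₀)) := by
        apply mul_le_mul_of_nonneg_left _ (by norm_num)
        exact div_le_div_of_nonneg_right hDC hlog.le
    _ = 2 * C / (Real.log t₁ - Real.log t₀) := by ring

/-- **The slowness can be made arbitrarily small by deepening the core**: for every `ℓ > 0` and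
`t₁ > 0` there is `t₀ ∈ (0, t₁)` with `t |λ'(t)| ≤ ℓ` for all `t > 0`. [folklore] -/
theorem exists_logPacing_slow {t₁ ℓ : ℝ} (ht₁ : 0 < t₁) (hℓ : 0 < ℓ) :
    ∃ t₀ : ℝ, 0 < t₀ ∧ t₀ < t₁ ∧ ∀ t : ℝ, 0 < t → t * |deriv (logPacing t₀ t₁) t| ≤ ℓ := by
  obtain ⟨C, hC0, hC⟩ := exists_deriv_smoothTransition_bound
  -- choose `t₀ = t₁ · exp (−(2C/ℓ + 1))`
  set K : ℝ := 2 * C / ℓ + 1 with hK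
  have hK0 : 0 < K := by positivity
  refine ⟨t₁ * Real.exp (-K), by positivity, ?_, fun t ht => ?_⟩
  · calc t₁ * Real.exp (-K) < t₁ * 1 := by
          apply mul_lt_mul_of_pos_left _ ht₁
          exact Real.exp_lt_one_iff.2 (by linarith)
      _ = t₁ := mul_one _
  · have h₀ : 0 < t₁ * Real.exp (-K) := by positivity
    have h₁ : t₁ * Real.exp (-K) < t₁ := by
      calc t₁ * Real.exp (-K) < t₁ * 1 := by
            apply mul_lt_mul_of_pos_left _ ht₁
            exact Real.exp_lt_one_iff.2 (by linarith)
        _ = t₁ := mul_one _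
    refine (abs_mul_deriv_logPacing_le h₀ h₁ hC ht).trans ?_
    have hquot : t₁ / (t₁ * Real.exp (-K)) = Real.exp K := by
      rw [Real.exp_neg]; field_simp
    rw [hquot, Real.log_exp, div_le_iff₀ hK0, hK]
    have : ℓ * (2 * C / ℓ + 1) = 2 * C + ℓ := by field_simp
    rw [this]; linarith

end Literature.Topology.FourManifolds
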